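import Literature.MathematicalPhysics.QuantumFieldTheory.Balaban1983to89.B14Eq21Admissible
import Literature.MathematicalPhysics.QuantumFieldTheory.Balaban1983to89.B14Eq216Concrete
import Literature.MathematicalPhysics.QuantumFieldTheory.Balaban1983to89.Step
import Literature.MathematicalPhysics.QuantumFieldTheory.Balaban1983to89.B14Cor3

/-!
# `Balaban1983to89.B14Eq218Concrete` — CMP 119 (2.18) p. 257: the REPRESENTATION OF THE k-TH DENSITY
# `ρ_k(V_k) = Σ_{{Ω_j},{Λ_j}} χ_k(Ω_k) 𝐓_k({Ω_j},{Λ_j}) exp A_k(1/g_k², U_k)` WITH ITS TWO MISSING BODIES —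
# the summation index «over the admissible sequences of domains» as the FINITE TYPE of (2.1)-chains
# `Ω₁ ⊃ Λ₁ ⊃ Ω₂ ⊃ … ⊃ Ω_k ⊃ Λ_k`, `Ω_j, Λ_j ∈ 𝐃_j`, and the small-field factor `χ_k(Ω_k)` as (2.17)
# (`B14.Eq216Concrete.chi217`) over the cubes `□ ⊂ Ω_k`; the background field `U_k = U(𝐁({Ω_j}))(V)` of
# (2.12)–(2.13) by name; the operation `𝐓_k` at print's own level for §2 (left undefined, p. 254)

statement-level skeleton of published theorems with citation tags; proofs where landed; nothing here is a claim
about the Yang–Mills mass gap.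

CITATION HEADER (lean-in-tree rule).  Source: T. Bałaban, *Convergent renormalization expansions for lattice gauge
theories*, Commun. Math. Phys. **119**, 243–285 (1988), doi:10.1007/bf01217741 [Balaban1988Convergent] (cell paper
B14 = «[III]»; held `paper:balaban1988-cmp119-convergent-renormalization`, journal page = PDF page + 242; p. 257
read for this file on the x2 render `…-p015-x2.png`, pp. 253–254 on `…-p011/p012-x2.png` and the text layer
`p0011`–`p0016`).  Mega-formalization `lit-balaban`, unit `lit-balaban-r11` gen 100 (B14 fold owner), SKELETON row
**B14.Eq2.18** — whose no-flip record (owner audit `READING-RULE-AUDIT-B14-g96.md` §A9, under the lead's READING RULE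
FOR DEFINITION DISPLAYS (a)–(d) and B12-Q9) names exactly two defects of the pre-cell carrier `Step.Repr218`:
*«summation “over the admissible sequences of domains” = abstract finite type `Repr218.Adm`; χ_k slot abstract though
(2.17) `chi217` exists»*.  This file supplies both bodies; it modifies nothing (the pre-cell record `Step.Repr218` stays
as it is — the new objects INSTANTIATE it), and serves rows B14.Eq1.28–1.30 ((1.28) = the case `k = 1`) by name.

THE PRINTED TEXT (p. 257 [PDF 15], verbatim).  *«Let us write now a general form of the expansion of the density ρ_k.
At first we define
    χ_k(Ω_k) = Π_{□⊂Ω_k} χ({sup_{p⊂□^∼} |U_{k,□}(V_k, ∂p) − 1| < ε_kη²}),   (2.17)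
where the cubes □ belong to the partition of the lattice T_η into cubes of the size LM₂R_k. This partition is
compatible with all other partitions of this lattice. The density ρ_k(V_k) can be represented as
    ρ_k(V_k) = Σ_{{Ω_j},{Λ_j}} χ_k(Ω_k) 𝐓_k({Ω_j},{Λ_j}) exp A_k(1/g_k², U_k),   (2.18)
where the summation is over the admissible sequences of domains. Summation over the sequences {S_j} is included in
the operation 𝐓_k, and the effective action A_k depends on the sequences {Ω_j},{Λ_j},{S_j}. We suppress this
dependence in our notation, so we will write simply 𝐓_k, A_k.  At first we describe in general the operation 𝐓_k. It
was described in detail in the first step, and the complete inductive definition will follow from constructions of the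
subsequent sections.»*  p. 254 [PDF 12], §2 opening: *«It is written explicitly, as in (1.28)–(1.30) for the first
step, except that the operations corresponding to the operation 𝐓₁ in (1.29) are left undefined, only their basic
general properties are formulated.»* and (2.1): *«We consider sequences of localization domains {Ω_j}, j = 1, 2, …, k,
Ω_j ∈ 𝐃_j, such that Ω₁ ⊃ Ω₂ ⊃ … ⊃ Ω_k. For such a sequence we consider sequences of localization domains {Λ_j},
Λ_j ∈ 𝐃_j, such that Ω₁ ⊃ Λ₁ ⊃ Ω₂ ⊃ Λ₂ ⊃ … ⊃ Ω_j ⊃ Λ_j ⊃ … ⊃ Ω_k ⊃ Λ_k. (2.1) … we admit the possibility that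
Λ_j = Ω_j for some indices j.»*  p. 258: *«The action A_k … depends on the gauge field variable V, given by (2.10),
through the background field U_k(V). This field is determined by the sequence {Ω_j}, or rather its determining set
𝐁.»*  p. 255: *«We denote further Z_j = Λ_jᶜ. (2.3)»*  p. 253 (1.28): *«ρ₁(V₁) = Σ_{Ω₁,Λ₁} χ₁(Ω₁)𝐓₁({Ω₁,Λ₁})
exp A₁(1/g₁², U₁)»*.

THE CARRIERS (pre-existing, BY NAME).  The multi-scale gauge variables `V = {V_j}` of (2.10) and the determining
sets are r12's `B15DeterminingSets.MSField P G` / `DetSet P` over the `Setup` tori `Site P j`; the determining set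
`𝐁 = 𝐁({Ω_j})` of a sequence is (2.2) `genSet Ω k` (row B14.Eq2.2 `proved`: *«𝐁 determines {Ω_j}»*,
`B14.Eq22Determines`); the (2.12) solution map `U(𝐁)(V)` is the [15] datum `DetBackground.U` (row B14.Eq2.12: its
existence/uniqueness is [Balaban1985Variational] Thm 1, NOT asserted); (2.16)/(2.17) are `B14.Eq216Concrete.ukBox` /
`chi217` (rows B14.Eq2.16, B14.Eq2.17 `proved p365333`); the effective action (2.23) with (2.25), (2.30), (2.40)–(2.41)
substituted is the pre-cell `Step.LFActionData.action23` (row B14.Eq2.23 `proved p369026 · Step`; the summation ranges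
WITH BODY are r11 g99's `B14.Eq227LocalizedTerms.realise`, the smeared Wilson actions WITH BODY r11 g98's
`B14.Eq225Concrete.concrete`); the (2.1) admissibility of the full triple `{Ω_j}, {Λ_j}, {S_j}` on pv02's ℤᵈ cube
carrier is r11 g98's `B14.Eq21Admissible.Adm21` (row B14.Eq2.1 `proved p368721`).  The sequences of THIS file live on
the torus `Site P 0` (where the determining sets and (2.16)–(2.17) live); §1's chain predicate is stated over an
arbitrary point type and linked to `Adm21` (`Adm21.chain21`).

WHAT THIS FILE TYPES AND PROVES (0 `sorry`; no named fact — the (2.18) predicate `Holds218 𝒟 ρ` is the pre-cell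
`Step.Repr218.Holds` INSTANTIATED, a predicate on `ρ`; three structures and the `def`s of §§2–6, all WITH BODY, +
theorems).
* §1 **(2.1) for the pair `({Ω_j}, {Λ_j})`** over any point type: `Chain21 D k Ω Λ` (`Ω_j, Λ_j ∈ 𝐃_j`, `Λ_j ⊆ Ω_j`,
  `Ω_{j+1} ⊆ Λ_j` — the four (Ω,Λ)-clauses of `Adm21` verbatim), its chain consequences (`Ω_antitone`, `Λ_antitone`,
  `Λ_subset_Ω_of_le`), the degenerate case *«Λ_j = Ω_j»* (`of_eq`), and the LINK to the (2.1) member of record: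
  `Adm21.chain21` (every admissible triple gives a chain) — (2.18)'s own words: the sum is over `{Ω_j},{Λ_j}`,
  *«Summation over the sequences {S_j} is included in the operation 𝐓_k»*.
* §2 **THE SUMMATION INDEX OF (2.18) WITH BODY**: the type `Seq D k` of (2.1)-chains of length `k` (normalised to `∅`
  off the index window `1 ≤ j ≤ k`, so that one printed sequence is one index), FINITE on the torus (`Finite`/`Fintype`
  instances — print's T_η is a finite lattice, the classes 𝐃_j are finite families); `Seq.ofChain` (any chain gives an
  index), `Seq.top` (the term without large fields: `Ω_j = Λ_j = T_η`, `Z_k = ∅` — B15 (0.2)'s small-field term), and the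
  case `k = 1` = (1.28)'s index *«Σ_{Ω₁,Λ₁}»*: `Seq D 1 ≃ {(Ω₁, Λ₁) ∈ 𝐃₁ × 𝐃₁ | Λ₁ ⊆ Ω₁}` (`seqOneEquiv`).
* §3 **«□ ⊂ Ω_k» WITH BODY**: `cubesIn cube Ω` = the cubes of the (finite) LM₂R_k-partition whose point sets lie in
  `Ω` (the product range of (2.17)), with `mem_cubesIn`, monotonicity, `cubesIn_univ`.
* §4 **THE SUMMAND OF (2.18) WITH BODY**: `Ubg bg k s V = U(𝐁({Ω_j(s)}))(V)` (p. 258 *«the background field U_k(V) …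
  determined by the sequence {Ω_j}, or rather its determining set 𝐁»*, (2.12)–(2.13) with (2.2)); `expA act bg s` =
  the function `(𝔞, V) ↦ exp A_k(1/g_k², U_k(V))` of the integration variables (`𝔞` = the fluctuation fields and
  `{S_j}`-data, filling the fluctuation slot of the action record `act s : Step.LFActionData` of the sequence — print's
  *«the effective action A_k depends on the sequences {Ω_j},{Λ_j},{S_j}»*), `chi218` = (2.17) at `Ω_k(s)`; the operation
  `𝐓_k({Ω_j},{Λ_j})` enters as the
  PARAMETER `Tk s : (𝔄 → MSField P G → ℝ) → Density P k G` — print's own level for §2 (p. 254 *«left undefined, only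
  their basic general properties are formulated»*, p. 257 *«Basically this operation is a composition of integrations
  … and multiplications by characteristic functions, δ-functions …, and gauge fixing expressions»*; its laws
  (2.19)–(2.22) are row B14.Eq2.20, `Step.TkOps.Laws`).
* §5 **(2.18) WITH BODY**: `repr218 … : Step.Repr218 P G k` with `Adm := Seq D k`, `χ s := χ_k(Ω_k(s))` (2.17),
  `TexpA s := 𝐓_k(s) exp A_k(1/g_k², U_k)`, `lastZ s := Z_k = Λ_kᶜ` (2.3); `Holds218 … ρ_k` := `Repr218.Holds`, and
  `holds218_iff` = the display (2.18) verbatim: `ρ_k(V_k) = Σ_{s} χ_k(Ω_k(s))(V_k) · (𝐓_k(s) exp A_k(1/g_k², U_k))(V_k)`.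
* §6 **WHERE PRINT CONSUMES (2.18)** (p. 264, Corollary 3 (2.50): the tree's consumers `B14Cor3.density_le_of_repr218` /
  `density_ge_of_repr218` / `partitionFn_le_of_repr218` take ANY `Step.Repr218`, hence this one): the sign facts they
  ask for, PROVED for the concrete summands — `chi217_nonneg`, `chi217_le_one`, `expA_pos`, and `term_nonneg` (every
  summand of (2.18) is `≥ 0` as soon as `𝐓_k` preserves positivity, print's *«composition of integrations … and
  multiplications by characteristic functions»*), `density_ge_smallField` (the lower bound by the no-large-field term,
  p. 264 *«we restrict to the small-field term»* shape); the regrouping of (2.18) by the last large-field region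
  `Z_k` = B15 (0.2) (`sum_piece218`, from `Step.Repr218.sum_piece`) with `lastZ top = ∅`.

HONEST SCOPE.  (1) (2.18) is an inductive ASSUMPTION (p. 262: *«All the inductive assumptions are formulated for the
effective density obtained after the k-th operation 𝐑T»*); its assertion at every `k` is Theorem 1 (row B14.Thm1) —
nothing of that is claimed here: `Holds218 … ρ` is a predicate on `ρ`.  (2) Parameters (READING RULE (a), printed
objects entering as parameters): the classes `𝐃_j` (`D`; print's instance = the p. 256 classes, row B14.Def§2.p256),
the LM₂R_k-cube partition with its `□^∼`-plaquettes and `□^{∼4}` (`cube`, `plaqT`, `enl4`, exactly as in `chi217`), the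
[15] solution map `bg`, `M₁`, `ε_k`, the operation `𝐓_k` and the action records `act s` (print's instance:
`B14.Eq227LocalizedTerms.realise` of `B14.Eq225Concrete.concrete` along `s`).  (3) (1.29) (the BODY
of `𝐓₁`) and the one-carrier instantiation of the tower (B14-CLOSURE §3 item 3) are not attempted.

v1.1 (r11 gen 102, DOCSTRING-ONLY citation-locator fix; summit-lit1 CITELOC #26 row P98-008 of 2026-08-24, decision of
record «(B14, (1.4), p.247) → p.246»): the two tags of `chiSmall_nonneg` / `chiSmall_le_one` read «(1.4) p.247»; the
display (1.4) — the small-field decomposition of unity *«1 = Σ Π χ(…) Π χ(…) = Σ χ₁ᶜ(P₁)χ₁(P₁ᶜ)»* — is printed on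
p. 246 [PDF 4] (text layer p0004 L29–31), while p. 247 [PDF 5] opens with (1.5); the tags now read «(1.4) p.246», as the
thirteen other B14 loci of the tree do.  No declaration touched.

## References
* [Balaban1988Convergent] T. Bałaban, Commun. Math. Phys. 119 (1988) 243–285: (1.4) p. 246, (1.28)–(1.30) pp. 253–254,
  §2 p. 254, (2.1)–(2.3) pp. 254–255, (2.10)–(2.13) pp. 256–257, (2.16)–(2.18) p. 257, (2.19)–(2.23) p. 258, Cor. 3
  (2.50) p. 264.
* [Balaban1989LargeFieldI] T. Bałaban, Commun. Math. Phys. 122 (1989) 175–202: (0.2) p. 176.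
* [Balaban1985Variational] T. Bałaban, Commun. Math. Phys. 102 (1985) 277–309: Thm 1 p. 279 (the datum `bg`).
-/

open Set
open scoped BigOperators

namespace Literature.MathematicalPhysics.QuantumFieldTheory.Balaban1983to89.B14.Eq218Concrete

open Literature.MathematicalPhysics.QuantumFieldTheory.Balaban1983to89
open B15DeterminingSets Step

/-! ## §1  (2.1) for the pair `({Ω_j}, {Λ_j})` over any point type -/

section Chain

variable {α : Type*}

/-- **(2.1) p. 254 for the pair of sequences** `{Ω_j}, {Λ_j}`, `j = 1, …, k` (the summation variables of (2.18)),
verbatim: *«Ω_j ∈ 𝐃_j … Λ_j ∈ 𝐃_j, such that Ω₁ ⊃ Λ₁ ⊃ Ω₂ ⊃ Λ₂ ⊃ … ⊃ Ω_j ⊃ Λ_j ⊃ … ⊃ Ω_k ⊃ Λ_k (2.1) … we admit the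
possibility that Λ_j = Ω_j for some indices j»* — the four `(Ω, Λ)`-clauses of `B14.Eq21Admissible.Adm21`, over an
arbitrary point type `α` (print: the torus `T_η`; the ℤᵈ rendering is `Adm21`'s).  Values of the sequences at `j = 0`
and `j > k` are ignored. [cite: Balaban1988Convergent, (2.1) p.254] -/
structure Chain21 (D : ℕ → Set (Set α)) (k : ℕ) (Ω Λ : ℕ → Set α) : Prop where
  memΩ : ∀ j, 1 ≤ j → j ≤ k → Ω j ∈ D j
  memΛ : ∀ j, 1 ≤ j → j ≤ k → Λ j ∈ D j
  Λ_subset : ∀ j, 1 ≤ j → j ≤ k → Λ j ⊆ Ω j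
  Ω_succ_subset : ∀ j, 1 ≤ j → j < k → Ω (j + 1) ⊆ Λ j

namespace Chain21

variable {D : ℕ → Set (Set α)} {k : ℕ} {Ω Λ : ℕ → Set α}

/-- `Ω_{j+1} ⊆ Ω_j` along (2.1). [cite: Balaban1988Convergent, (2.1) p.254] -/
theorem Ω_succ_subset_Ω (h : Chain21 D k Ω Λ) {j : ℕ} (h1 : 1 ≤ j) (hj : j < k) : Ω (j + 1) ⊆ Ω j :=
  (h.Ω_succ_subset j h1 hj).trans (h.Λ_subset j h1 hj.le)

/-- `Λ_{j+1} ⊆ Λ_j` along (2.1). [cite: Balaban1988Convergent, (2.1) p.254] -/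
theorem Λ_succ_subset_Λ (h : Chain21 D k Ω Λ) {j : ℕ} (h1 : 1 ≤ j) (hj : j < k) : Λ (j + 1) ⊆ Λ j :=
  (h.Λ_subset (j + 1) (by omega) (by omega)).trans (h.Ω_succ_subset j h1 hj)

/-- `Ω_{j+n} ⊆ Ω_j` along (2.1). [cite: Balaban1988Convergent, (2.1) p.254] -/
theorem Ω_add_subset (h : Chain21 D k Ω Λ) {j : ℕ} (h1 : 1 ≤ j) : ∀ {n : ℕ}, j + n ≤ k → Ω (j + n) ⊆ Ω j
  | 0, _ => by simp
  | n + 1, hn => by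
    rw [← Nat.add_assoc]
    exact (h.Ω_succ_subset_Ω (j := j + n) (by omega) (by omega)).trans (h.Ω_add_subset h1 (by omega))

/-- `Λ_{j+n} ⊆ Λ_j` along (2.1). [cite: Balaban1988Convergent, (2.1) p.254] -/
theorem Λ_add_subset (h : Chain21 D k Ω Λ) {j : ℕ} (h1 : 1 ≤ j) : ∀ {n : ℕ}, j + n ≤ k → Λ (j + n) ⊆ Λ j
  | 0, _ => by simp
  | n + 1, hn => by
    rw [← Nat.add_assoc]
    exact (h.Λ_succ_subset_Λ (j := j + n) (by omega) (by omega)).trans (h.Λ_add_subset h1 (by omega))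

/-- *«Ω₁ ⊃ Ω₂ ⊃ … ⊃ Ω_k»*: the `Ω`-sequence is antitone on `1 ≤ j ≤ j′ ≤ k`. [cite: Balaban1988Convergent, (2.1) p.254] -/
theorem Ω_antitone (h : Chain21 D k Ω Λ) {j j' : ℕ} (h1 : 1 ≤ j) (hjj' : j ≤ j') (hj' : j' ≤ k) : Ω j' ⊆ Ω j := by
  obtain ⟨n, rfl⟩ := Nat.exists_eq_add_of_le hjj'
  exact h.Ω_add_subset h1 hj'

/-- The `Λ`-sequence is antitone on `1 ≤ j ≤ j′ ≤ k`. [cite: Balaban1988Convergent, (2.1) p.254] -/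
theorem Λ_antitone (h : Chain21 D k Ω Λ) {j j' : ℕ} (h1 : 1 ≤ j) (hjj' : j ≤ j') (hj' : j' ≤ k) : Λ j' ⊆ Λ j := by
  obtain ⟨n, rfl⟩ := Nat.exists_eq_add_of_le hjj'
  exact h.Λ_add_subset h1 hj'

/-- `Λ_{j′} ⊆ Ω_j` for `j ≤ j′` along (2.1). [cite: Balaban1988Convergent, (2.1) p.254] -/
theorem Λ_subset_Ω_of_le (h : Chain21 D k Ω Λ) {j j' : ℕ} (h1 : 1 ≤ j) (hjj' : j ≤ j') (hj' : j' ≤ k) :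
    Λ j' ⊆ Ω j :=
  (h.Λ_subset j' (h1.trans hjj') hj').trans (h.Ω_antitone h1 hjj' hj')

/-- Restriction to a smaller top index `k′ ≤ k`. [cite: Balaban1988Convergent, (2.1) p.254] -/
theorem mono_k (h : Chain21 D k Ω Λ) {k' : ℕ} (hk : k' ≤ k) : Chain21 D k' Ω Λ where
  memΩ j h1 hj := h.memΩ j h1 (hj.trans hk)
  memΛ j h1 hj := h.memΛ j h1 (hj.trans hk)
  Λ_subset j h1 hj := h.Λ_subset j h1 (hj.trans hk)
  Ω_succ_subset j h1 hj := h.Ω_succ_subset j h1 (lt_of_lt_of_le hj hk)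

/-- THE DEGENERATE CASE *«we admit the possibility that Λ_j = Ω_j for some indices j. Such a situation may arise as a
result of an R-operation»* (p. 255): with `Λ = Ω` the pair is a (2.1)-chain iff `{Ω_j}` is a chain in the classes.
[cite: Balaban1988Convergent, (2.1) p.255] -/
theorem of_eq (D : ℕ → Set (Set α)) (k : ℕ) (Ω : ℕ → Set α) (hmem : ∀ j, 1 ≤ j → j ≤ k → Ω j ∈ D j)
    (hchain : ∀ j, 1 ≤ j → j < k → Ω (j + 1) ⊆ Ω j) : Chain21 D k Ω Ω where
  memΩ := hmem
  memΛ := hmem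
  Λ_subset _ _ _ := le_rfl
  Ω_succ_subset := hchain

/-- The values of the sequences off the index window `1 ≤ j ≤ k` are irrelevant: two pairs agreeing on the window are
chains together. [cite: Balaban1988Convergent, (2.1) p.254] -/
theorem congr (h : Chain21 D k Ω Λ) {Ω' Λ' : ℕ → Set α} (hΩ : ∀ j, 1 ≤ j → j ≤ k → Ω' j = Ω j)
    (hΛ : ∀ j, 1 ≤ j → j ≤ k → Λ' j = Λ j) : Chain21 D k Ω' Λ' where
  memΩ j h1 hj := by rw [hΩ j h1 hj]; exact h.memΩ j h1 hj
  memΛ j h1 hj := by rw [hΛ j h1 hj]; exact h.memΛ j h1 hj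
  Λ_subset j h1 hj := by rw [hΩ j h1 hj, hΛ j h1 hj]; exact h.Λ_subset j h1 hj
  Ω_succ_subset j h1 hj := by
    rw [hΩ (j + 1) (by omega) (by omega), hΛ j h1 hj.le]; exact h.Ω_succ_subset j h1 hj

end Chain21

/-- THE LINK TO THE (2.1) MEMBER OF RECORD (pv02's ℤᵈ cube carrier): an admissible triple `{Ω_j}, {Λ_j}, {S_j}` of
`B14.Eq21Admissible.Adm21` gives the (2.1)-chain of its pair `({Ω_j}, {Λ_j})` — (2.18) sums over the pairs, *«Summation
over the sequences {S_j} is included in the operation 𝐓_k»*. [cite: Balaban1988Convergent, (2.1) p.254, (2.18) p.257] -/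
theorem _root_.Literature.MathematicalPhysics.QuantumFieldTheory.Balaban1983to89.B14.Eq21Admissible.Adm21.chain21
    {d : ℕ} {D : ℕ → Set (Set (B14DomainGeom.Pt d))} {sT sS : ℕ → ℕ} {k : ℕ} {Ω Λ S : ℕ → Set (B14DomainGeom.Pt d)}
    (h : B14.Eq21Admissible.Adm21 D sT sS k Ω Λ S) : Chain21 D k Ω Λ :=
  ⟨h.memΩ, h.memΛ, h.Λ_subset, h.Ω_succ_subset⟩

/-- Conversely, in the degenerate case `Λ_j = Ω_j`, `S_j = ∅` the chain condition IS full admissibility (2.1)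
(`Adm21.of_eq`). [cite: Balaban1988Convergent, (2.1) p.255] -/
theorem adm21_of_chain21_eq {d : ℕ} {D : ℕ → Set (Set (B14DomainGeom.Pt d))} (sT sS : ℕ → ℕ) {k : ℕ}
    {Ω : ℕ → Set (B14DomainGeom.Pt d)} (h : Chain21 D k Ω Ω) :
    B14.Eq21Admissible.Adm21 D sT sS k Ω Ω (fun _ => ∅) :=
  B14.Eq21Admissible.Adm21.of_eq D sT sS k Ω h.memΩ (fun j h1 hj => h.Ω_succ_subset j h1 hj)

end Chain

/-! ## §2  The summation index of (2.18) WITH BODY: the finite type of admissible `(Ω, Λ)`-sequences -/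

section Index

variable {α : Type*}

/-- **THE SUMMATION INDEX OF (2.18)** — *«where the summation is over the admissible sequences of domains»* `{Ω_j},
{Λ_j}`, `j = 1, …, k`: a pair of sequences satisfying (2.1), normalised to `∅` off the index window `1 ≤ j ≤ k` (so that
ONE printed sequence `(Ω₁, …, Ω_k; Λ₁, …, Λ_k)` is ONE index). [cite: Balaban1988Convergent, (2.18) p.257, (2.1) p.254] -/
structure Seq (D : ℕ → Set (Set α)) (k : ℕ) where
  Ω : ℕ → Set α
  Λ : ℕ → Set α
  chain : Chain21 D k Ω Λ
  Ω_off : ∀ j, ¬ (1 ≤ j ∧ j ≤ k) → Ω j = ∅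
  Λ_off : ∀ j, ¬ (1 ≤ j ∧ j ≤ k) → Λ j = ∅

namespace Seq

variable {D : ℕ → Set (Set α)} {k : ℕ}

/-- Two indices with the same sequences are equal. [cite: Balaban1988Convergent, (2.18) p.257] -/
theorem ext' {s t : Seq D k} (hΩ : s.Ω = t.Ω) (hΛ : s.Λ = t.Λ) : s = t := by
  cases s; cases t; cases hΩ; cases hΛ; rfl

/-- The restriction of an index to the window `j ≤ k` (as a pair of `Fin (k+1)`-families) — used only to prove
finiteness. [cite: Balaban1988Convergent, (2.18) p.257] -/
def window (s : Seq D k) : (Fin (k + 1) → Set α) × (Fin (k + 1) → Set α) :=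
  (fun i => s.Ω i, fun i => s.Λ i)

/-- An index is determined by its window. [cite: Balaban1988Convergent, (2.18) p.257] -/
theorem window_injective : Function.Injective (window (D := D) (k := k)) := by
  intro s t h
  have hΩ : ∀ i : Fin (k + 1), s.Ω i = t.Ω i := fun i => congrFun (congrArg Prod.fst h) i
  have hΛ : ∀ i : Fin (k + 1), s.Λ i = t.Λ i := fun i => congrFun (congrArg Prod.snd h) i
  apply ext'
  · funext j
    by_cases hj : j ≤ k
    · exact hΩ ⟨j, Nat.lt_succ_of_le hj⟩
    · rw [s.Ω_off j (fun h' => hj h'.2), t.Ω_off j (fun h' => hj h'.2)]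
  · funext j
    by_cases hj : j ≤ k
    · exact hΛ ⟨j, Nat.lt_succ_of_le hj⟩
    · rw [s.Λ_off j (fun h' => hj h'.2), t.Λ_off j (fun h' => hj h'.2)]

/-- **FINITENESS OF THE SUM (2.18)** on a finite lattice (print's torus `T_η`; then every class `𝐃_j ⊆ 𝒫(T_η)` is a
finite family): the admissible `(Ω, Λ)`-sequences of length `k` form a finite type. [cite: Balaban1988Convergent, (2.18) p.257] -/
instance instFinite [Finite α] : Finite (Seq D k) :=
  Finite.of_injective _ window_injective

/-- The `Fintype` structure on the summation index (so that `Σ_{{Ω_j},{Λ_j}}` of (2.18) elaborates as a `Finset.sum`).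
[cite: Balaban1988Convergent, (2.18) p.257] -/
noncomputable instance instFintype [Finite α] : Fintype (Seq D k) := Fintype.ofFinite _

/-- ANY (2.1)-chain gives an index (its normalisation off the window). [cite: Balaban1988Convergent, (2.1) p.254, (2.18) p.257] -/
def ofChain (Ω Λ : ℕ → Set α) (h : Chain21 D k Ω Λ) : Seq D k where
  Ω j := if 1 ≤ j ∧ j ≤ k then Ω j else ∅
  Λ j := if 1 ≤ j ∧ j ≤ k then Λ j else ∅
  chain := h.congr (fun j h1 hj => by simp [h1, hj]) (fun j h1 hj => by simp [h1, hj])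
  Ω_off j hj := by simp only [ite_eq_right_iff]; exact fun h' => (hj h').elim
  Λ_off j hj := by simp only [ite_eq_right_iff]; exact fun h' => (hj h').elim

/-- On the window the index of a chain has the chain's domains `Ω_j`. [cite: Balaban1988Convergent, (2.1) p.254] -/
@[simp] theorem ofChain_Ω {Ω Λ : ℕ → Set α} (h : Chain21 D k Ω Λ) {j : ℕ} (h1 : 1 ≤ j) (hj : j ≤ k) :
    (ofChain Ω Λ h).Ω j = Ω j := by simp [ofChain, h1, hj]

/-- On the window the index of a chain has the chain's domains `Λ_j`. [cite: Balaban1988Convergent, (2.1) p.254] -/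
@[simp] theorem ofChain_Λ {Ω Λ : ℕ → Set α} (h : Chain21 D k Ω Λ) {j : ℕ} (h1 : 1 ≤ j) (hj : j ≤ k) :
    (ofChain Ω Λ h).Λ j = Λ j := by simp [ofChain, h1, hj]

/-- **THE TERM WITHOUT LARGE FIELDS**: `Ω_j = Λ_j = T_η` for all `j ≤ k` (admissible as soon as the whole lattice is a
localization domain of every class) — the term whose last large-field region `Z_k = Λ_kᶜ` is EMPTY, i.e. the
small-field term `ρ(∅, V)` of [Balaban1989LargeFieldI] (0.2). [cite: Balaban1988Convergent, (2.1) p.255, (2.18) p.257] -/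
def top (D : ℕ → Set (Set α)) (k : ℕ) (huniv : ∀ j, 1 ≤ j → j ≤ k → (Set.univ : Set α) ∈ D j) : Seq D k :=
  ofChain (fun _ => Set.univ) (fun _ => Set.univ)
    (Chain21.of_eq D k _ huniv (fun _ _ _ => le_rfl))

/-- The no-large-field index has `Λ_k = T_η` (for `k ≥ 1`). [cite: Balaban1988Convergent, (2.1) p.255] -/
theorem top_Λ (huniv : ∀ j, 1 ≤ j → j ≤ k → (Set.univ : Set α) ∈ D j) (hk : 1 ≤ k) :
    (top D k huniv).Λ k = Set.univ := by
  simp [top, hk]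

/-- The no-large-field index has `Ω_k = T_η` (for `k ≥ 1`). [cite: Balaban1988Convergent, (2.1) p.255] -/
theorem top_Ω (huniv : ∀ j, 1 ≤ j → j ≤ k → (Set.univ : Set α) ∈ D j) (hk : 1 ≤ k) :
    (top D k huniv).Ω k = Set.univ := by
  simp [top, hk]

/-- **(1.28) p. 253 — THE CASE `k = 1`**: *«ρ₁(V₁) = Σ_{Ω₁,Λ₁} χ₁(Ω₁)𝐓₁({Ω₁,Λ₁}) exp A₁(1/g₁², U₁)»*; the index of
length `1` is exactly a pair `(Ω₁, Λ₁)` of domains of the class `𝐃₁` with `Λ₁ ⊆ Ω₁`. [cite: Balaban1988Convergent, (1.28) p.253, (2.1) p.254] -/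
noncomputable def seqOneEquiv (D : ℕ → Set (Set α)) :
    Seq D 1 ≃ {p : Set α × Set α // p.1 ∈ D 1 ∧ p.2 ∈ D 1 ∧ p.2 ⊆ p.1} where
  toFun s := ⟨(s.Ω 1, s.Λ 1), s.chain.memΩ 1 le_rfl le_rfl, s.chain.memΛ 1 le_rfl le_rfl,
    s.chain.Λ_subset 1 le_rfl le_rfl⟩
  invFun p := ofChain (fun _ => p.1.1) (fun _ => p.1.2)
    { memΩ := fun j h1 hj => by obtain rfl : j = 1 := le_antisymm hj h1; exact p.2.1
      memΛ := fun j h1 hj => by obtain rfl : j = 1 := le_antisymm hj h1; exact p.2.2.1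
      Λ_subset := fun _ _ _ => p.2.2.2
      Ω_succ_subset := fun j h1 hj => by omega }
  left_inv s := by
    apply ext'
    · funext j
      by_cases hj : 1 ≤ j ∧ j ≤ 1
      · obtain rfl : j = 1 := le_antisymm hj.2 hj.1
        simp [ofChain]
      · rw [s.Ω_off j hj]; simp [ofChain, hj]
    · funext j
      by_cases hj : 1 ≤ j ∧ j ≤ 1
      · obtain rfl : j = 1 := le_antisymm hj.2 hj.1
        simp [ofChain]
      · rw [s.Λ_off j hj]; simp [ofChain, hj]
  right_inv p := by
    apply Subtype.ext
    simp [ofChain]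

end Seq

end Index

/-! ## §3  «□ ⊂ Ω_k» WITH BODY: the cubes of the LM₂R_k-partition inside a domain -/

section Cubes

variable {α ι : Type*} [Fintype ι]

open Classical in
/-- **The product range of (2.17)** — *«Π_{□⊂Ω_k} … where the cubes □ belong to the partition of the lattice T_η into
cubes of the size LM₂R_k»*: the (finite) family of partition cubes `c : ι` whose point set `cube c` lies in `Ω`.  (The
partition and its point sets are parameters, as the cube family `X` is in `B14.Eq216Concrete.chi217`.) [cite: Balaban1988Convergent, (2.17) p.257] -/
noncomputable def cubesIn (cube : ι → Set α) (Ω : Set α) : Finset ι :=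
  Finset.univ.filter fun c => cube c ⊆ Ω

/-- `□ ∈ cubesIn Ω ↔ □ ⊂ Ω`. [cite: Balaban1988Convergent, (2.17) p.257] -/
@[simp] theorem mem_cubesIn (cube : ι → Set α) (Ω : Set α) (c : ι) : c ∈ cubesIn cube Ω ↔ cube c ⊆ Ω := by
  classical
  simp [cubesIn]

/-- A larger domain contains more partition cubes. [cite: Balaban1988Convergent, (2.17) p.257] -/
theorem cubesIn_mono (cube : ι → Set α) {Ω Ω' : Set α} (h : Ω ⊆ Ω') : cubesIn cube Ω ⊆ cubesIn cube Ω' := by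
  intro c hc
  rw [mem_cubesIn] at hc ⊢
  exact hc.trans h

/-- Every partition cube lies in the whole lattice. [cite: Balaban1988Convergent, (2.17) p.257] -/
@[simp] theorem cubesIn_univ (cube : ι → Set α) : cubesIn cube (Set.univ : Set α) = Finset.univ := by
  ext c; simp

end Cubes

/-! ## §4  The summand of (2.18) WITH BODY: `U_k = U(𝐁({Ω_j}))(V)`, `exp A_k(1/g_k², U_k)`, `χ_k(Ω_k)` -/

section Summand

variable {P : Params} {G : Type*} [GaugeGroup G] {av : ∀ j, Averaging P j G}
variable {D : ℕ → Set (Set (Site P 0))} {k : ℕ}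

/-- **THE BACKGROUND FIELD OF A SEQUENCE** — p. 258: *«[A_k] depends on the gauge field variable V, given by (2.10),
through the background field U_k(V). This field is determined by the sequence {Ω_j}, or rather its determining set
𝐁»*: `U_k(V) = U(𝐁({Ω_j}))(V)` with the determining set (2.2) `𝐁 = genSet Ω k` of the sequence and the (2.12)
solution map `U(𝐁)(·)` of the [15] datum `bg` ((2.13): *«U(𝐁_j(Ω), ·) = U_{j,Ω}(·)»*), `V = {V_j}` the multi-scale
variables of (2.10). [cite: Balaban1988Convergent, (2.12)–(2.13) pp.256–257, §2 p.258] -/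
def Ubg (bg : DetBackground P G av) (k : ℕ) (s : Seq D k) (V : MSField P G) : GaugeField P 0 G :=
  bg.U (genSet s.Ω k) V

/-- Unfolding of `Ubg`. [cite: Balaban1988Convergent, (2.12)–(2.13) pp.256–257] -/
theorem Ubg_apply (bg : DetBackground P G av) (k : ℕ) (s : Seq D k) (V : MSField P G) :
    Ubg bg k s V = bg.U (genSet s.Ω k) V := rfl

/-- `U_k(V)` IS a minimal configuration of (2.12) for the determining set `𝐁({Ω_j})` and the data `V` (for data in the
domain of the solution map). [cite: Balaban1988Convergent, (2.12) p.256] -/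
theorem isMinimizer_Ubg (bg : DetBackground P G av) (k : ℕ) (s : Seq D k) {V : MSField P G}
    (hV : V ∈ bg.dom (genSet s.Ω k)) : IsMinimizer av bg.reg (genSet s.Ω k) V (Ubg bg k s V) :=
  bg.isMinimizer _ _ hV

variable {Φ 𝒢 𝔄 : Type*} {T : LFTower P G Φ 𝒢 𝔄}

/-- **`exp A_k(1/g_k², U_k)` AS A FUNCTION OF THE INTEGRATION VARIABLES** — the operand of `𝐓_k` in (2.18): for the
fluctuation-field/`{S_j}`-data `𝔞` and the gauge variables `V` of (2.10), `exp A_k(1/g_k², U_k(V))` with `A_k` the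
effective action (2.23) (`Step.LFActionData.action23`, with (2.25), (2.30), (2.40)–(2.41) substituted) of the action
record `act s` of the sequence — print: *«the effective action A_k depends on the sequences {Ω_j},{Λ_j},{S_j}»* — whose
fluctuation slot (the argument `(A, {S_i})` of the boundary terms `𝐁_k(U_k, A)` in (2.23)) is set to `𝔞`, evaluated at
the background field `U_k(V)` of the sequence. [cite: Balaban1988Convergent, (2.18) p.257, (2.23) p.258] -/
noncomputable def expA (act : Seq D k → LFActionData P G T) (bg : DetBackground P G av) (s : Seq D k)
    (𝔞 : 𝔄) (V : MSField P G) : ℝ :=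
  Real.exp (({ act s with fluct := 𝔞 } : LFActionData P G T).action23 k (Ubg bg k s V))

/-- Unfolding of `expA`. [cite: Balaban1988Convergent, (2.18) p.257, (2.23) p.258] -/
theorem expA_apply (act : Seq D k → LFActionData P G T) (bg : DetBackground P G av) (s : Seq D k)
    (𝔞 : 𝔄) (V : MSField P G) :
    expA act bg s 𝔞 V =
      Real.exp (({ act s with fluct := 𝔞 } : LFActionData P G T).action23 k (bg.U (genSet s.Ω k) V)) := rfl

/-- The operand `exp A_k(1/g_k², U_k)` is positive. [cite: Balaban1988Convergent, (2.18) p.257] -/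
theorem expA_pos (act : Seq D k → LFActionData P G T) (bg : DetBackground P G av) (s : Seq D k)
    (𝔞 : 𝔄) (V : MSField P G) : 0 < expA act bg s 𝔞 V :=
  Real.exp_pos _

variable {ι : Type*} [Fintype ι]

/-- **`χ_k(Ω_k)` OF (2.18)** = (2.17) (`B14.Eq216Concrete.chi217`) over the cubes `□ ⊂ Ω_k` of the sequence's last
domain `Ω_k`: `Π_{□⊂Ω_k} χ({sup_{p⊂□^∼}|U_{k,□}(V_k,∂p) − 1| < ε_kη²})`; the partition cubes' point sets `cube`, their
plaquette families `plaqT □ = {p ⊂ □^∼}` and enlargements `enl4 □ = □^{∼4}`, the [15] map `bg`, `M₁` and `ε_k` as in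
`chi217`. [cite: Balaban1988Convergent, (2.17)–(2.18) p.257] -/
noncomputable def chi218 (bg : DetBackground P G av) (M₁ : ℕ) (cube : ι → Set (Site P 0))
    (plaqT : ι → Set (Plaq P 0)) (enl4 : ι → Set (Site P 0)) (εk : ℝ) (k : ℕ) (s : Seq D k) : Density P k G :=
  B14.Eq216Concrete.chi217 bg M₁ (cubesIn cube (s.Ω k)) plaqT enl4 εk k

/-- Unfolding of `chi218` to (2.17). [cite: Balaban1988Convergent, (2.17)–(2.18) p.257] -/
theorem chi218_apply (bg : DetBackground P G av) (M₁ : ℕ) (cube : ι → Set (Site P 0)) (plaqT : ι → Set (Plaq P 0))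
    (enl4 : ι → Set (Site P 0)) (εk : ℝ) (k : ℕ) (s : Seq D k) (Vk : GaugeField P k G) :
    chi218 bg M₁ cube plaqT enl4 εk k s Vk =
      ∏ c ∈ cubesIn cube (s.Ω k),
        chiSmall (plaqT c) (εk * P.eta k ^ 2) (B14.Eq216Concrete.ukBox bg M₁ (enl4 c) k Vk) := rfl

/-- The small-field factor `χ({…})` of `Setup` takes values in `{0, 1}`, hence is `≥ 0` (the same two-line fact as
pub-balaban's `T4ExpWindowSmallField.chiSmall_nonneg`, restated here so as not to import the T4 chart modules).
[cite: Balaban1988Convergent, (1.4) p.246] -/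
theorem chiSmall_nonneg {j : ℕ} (S : Set (Plaq P j)) (δ : ℝ) (U : GaugeField P j G) : 0 ≤ chiSmall S δ U := by
  unfold chiSmall; split_ifs <;> norm_num

/-- The small-field factor `χ({…})` of `Setup` is `≤ 1` (= pub-balaban's `T4ExpWindowSmallField.chiSmall_le_one`,
restated for the same reason). [cite: Balaban1988Convergent, (1.4) p.246] -/
theorem chiSmall_le_one {j : ℕ} (S : Set (Plaq P j)) (δ : ℝ) (U : GaugeField P j G) : chiSmall S δ U ≤ 1 := by
  unfold chiSmall; split_ifs <;> norm_num

omit [Fintype ι] in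
/-- (2.17) is a product of characteristic functions, hence `χ_k(Ω_k) ≥ 0`. [cite: Balaban1988Convergent, (2.17) p.257] -/
theorem chi217_nonneg (bg : DetBackground P G av) (M₁ : ℕ) (X : Finset ι) (plaqT : ι → Set (Plaq P 0))
    (enl4 : ι → Set (Site P 0)) (εk : ℝ) (k : ℕ) (Vk : GaugeField P k G) :
    0 ≤ B14.Eq216Concrete.chi217 bg M₁ X plaqT enl4 εk k Vk := by
  rw [B14.Eq216Concrete.chi217_apply]
  exact Finset.prod_nonneg fun c _ => chiSmall_nonneg _ _ _

omit [Fintype ι] in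
/-- (2.17) is a product of characteristic functions, hence `χ_k(Ω_k) ≤ 1`. [cite: Balaban1988Convergent, (2.17) p.257] -/
theorem chi217_le_one (bg : DetBackground P G av) (M₁ : ℕ) (X : Finset ι) (plaqT : ι → Set (Plaq P 0))
    (enl4 : ι → Set (Site P 0)) (εk : ℝ) (k : ℕ) (Vk : GaugeField P k G) :
    B14.Eq216Concrete.chi217 bg M₁ X plaqT enl4 εk k Vk ≤ 1 := by
  rw [B14.Eq216Concrete.chi217_apply]
  exact Finset.prod_le_one (fun c _ => chiSmall_nonneg _ _ _) fun c _ => chiSmall_le_one _ _ _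

/-- `χ_k(Ω_k(s)) ≥ 0` for every index of (2.18). [cite: Balaban1988Convergent, (2.17)–(2.18) p.257] -/
theorem chi218_nonneg (bg : DetBackground P G av) (M₁ : ℕ) (cube : ι → Set (Site P 0)) (plaqT : ι → Set (Plaq P 0))
    (enl4 : ι → Set (Site P 0)) (εk : ℝ) (k : ℕ) (s : Seq D k) (Vk : GaugeField P k G) :
    0 ≤ chi218 bg M₁ cube plaqT enl4 εk k s Vk :=
  chi217_nonneg bg M₁ _ plaqT enl4 εk k Vk

/-- `χ_k(Ω_k(s)) ≤ 1` for every index of (2.18). [cite: Balaban1988Convergent, (2.17)–(2.18) p.257] -/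
theorem chi218_le_one (bg : DetBackground P G av) (M₁ : ℕ) (cube : ι → Set (Site P 0)) (plaqT : ι → Set (Plaq P 0))
    (enl4 : ι → Set (Site P 0)) (εk : ℝ) (k : ℕ) (s : Seq D k) (Vk : GaugeField P k G) :
    chi218 bg M₁ cube plaqT enl4 εk k s Vk ≤ 1 :=
  chi217_le_one bg M₁ _ plaqT enl4 εk k Vk

/-- For the no-large-field index (`Ω_k = T_η`) the product (2.17) runs over ALL cubes of the partition.
[cite: Balaban1988Convergent, (2.17) p.257] -/
theorem chi218_top (bg : DetBackground P G av) (M₁ : ℕ) (cube : ι → Set (Site P 0)) (plaqT : ι → Set (Plaq P 0))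
    (enl4 : ι → Set (Site P 0)) (εk : ℝ) (huniv : ∀ j, 1 ≤ j → j ≤ k → (Set.univ : Set (Site P 0)) ∈ D j)
    (hk : 1 ≤ k) (Vk : GaugeField P k G) :
    chi218 bg M₁ cube plaqT enl4 εk k (Seq.top D k huniv) Vk =
      ∏ c : ι, chiSmall (plaqT c) (εk * P.eta k ^ 2) (B14.Eq216Concrete.ukBox bg M₁ (enl4 c) k Vk) := by
  rw [chi218_apply, Seq.top_Ω huniv hk, cubesIn_univ]

end Summand

/-! ## §5  (2.18) WITH BODY -/

section Representation

variable {P : Params} {G : Type*} [GaugeGroup G] {av : ∀ j, Averaging P j G}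
variable {Φ 𝒢 𝔄 : Type*} {T : LFTower P G Φ 𝒢 𝔄} {ι : Type*} [Fintype ι]

/-- THE DATA OF (2.17)–(2.18) at scale `k` over the classes `𝐃_j = D j`: the [15] solution map `bg` and the averaging
parameter `M₁` of (2.13)/(2.16), the LM₂R_k-partition (`cube`, `plaqT`, `enl4` as in `chi217`), `ε_k`, the operations
`𝐓_k({Ω_j},{Λ_j})` — p. 254: *«left undefined, only their basic general properties are formulated»*, p. 257: *«a
composition of integrations restricted to large field regions in successive scales, and multiplications by
characteristic functions, δ-functions defining renormalization transformations, and gauge fixing expressions»*; here: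
for each index an operation taking a function of the integration variables `(𝔞, V)` (the fluctuation fields with the
`{S_j}`-data, *«Summation over the sequences {S_j} is included in the operation 𝐓_k»*, and the gauge variables (2.10))
to a function of `V_k` — and the action records `act s` of (2.23) (*«the effective action A_k depends on the
sequences {Ω_j},{Λ_j},{S_j}»*; the fluctuation slot is filled by the integration variable `𝔞`, see `expA`).
[cite: Balaban1988Convergent, (2.17)–(2.18) p.257, §2 p.254] -/
structure Data218 (P : Params) (G : Type*) [GaugeGroup G] (av : ∀ j, Averaging P j G) {Φ 𝒢 𝔄 : Type*}
    (T : LFTower P G Φ 𝒢 𝔄) (ι : Type*) (D : ℕ → Set (Set (Site P 0))) (k : ℕ) where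
  bg : DetBackground P G av
  M₁ : ℕ
  cube : ι → Set (Site P 0)
  plaqT : ι → Set (Plaq P 0)
  enl4 : ι → Set (Site P 0)
  εk : ℝ
  Tk : Seq D k → (𝔄 → MSField P G → ℝ) → Density P k G
  act : Seq D k → LFActionData P G T

variable {D : ℕ → Set (Set (Site P 0))} {k : ℕ}

namespace Data218

/-- `χ_k(Ω_k(s))` of the data (2.17). [cite: Balaban1988Convergent, (2.17) p.257] -/
noncomputable def χ (𝒟 : Data218 P G av T ι D k) (s : Seq D k) : Density P k G :=
  chi218 𝒟.bg 𝒟.M₁ 𝒟.cube 𝒟.plaqT 𝒟.enl4 𝒟.εk k s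

/-- `𝐓_k({Ω_j},{Λ_j}) exp A_k(1/g_k², U_k)` of the data: the operation of the index applied to the operand `expA`.
[cite: Balaban1988Convergent, (2.18) p.257] -/
noncomputable def TexpA (𝒟 : Data218 P G av T ι D k) (s : Seq D k) : Density P k G :=
  𝒟.Tk s (expA 𝒟.act 𝒟.bg s)

/-- **(2.18) WITH BODY as an instance of the pre-cell carrier `Step.Repr218`**: summation index `Adm := Seq D k` (the
admissible `(Ω, Λ)`-sequences, §2), `χ s := χ_k(Ω_k(s))` (2.17), `TexpA s := 𝐓_k(s) exp A_k(1/g_k², U_k)` (§4), and the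
last large-field region `lastZ s := Z_k = Λ_kᶜ` (2.3) used by [Balaban1989LargeFieldI] (0.2) to regroup the sum.
[cite: Balaban1988Convergent, (2.18) p.257, (2.3) p.255] -/
noncomputable def repr218 (𝒟 : Data218 P G av T ι D k) : Step.Repr218 P G k where
  Adm := Seq D k
  Zs := Set (Site P 0)
  finZs := Fintype.ofFinite _
  decZs := Classical.decEq _
  χ := 𝒟.χ
  TexpA := 𝒟.TexpA
  lastZ s := (s.Λ k)ᶜ

/-- The summation index of `repr218` is the type of admissible `(Ω, Λ)`-sequences. [cite: Balaban1988Convergent, (2.18) p.257] -/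
theorem repr218_Adm (𝒟 : Data218 P G av T ι D k) : 𝒟.repr218.Adm = Seq D k := rfl

/-- The last large-field region of an index is `Z_k = Λ_kᶜ` (2.3). [cite: Balaban1988Convergent, (2.3) p.255] -/
theorem repr218_lastZ (𝒟 : Data218 P G av T ι D k) (s : Seq D k) : 𝒟.repr218.lastZ s = (s.Λ k)ᶜ := rfl

/-- **(2.18) for a density `ρ_k`** (the inductive assumption on the k-th density; asserted at every `k` by Theorem 1,
row B14.Thm1 — NOT here): `Holds218 𝒟 ρ_k` := `Step.Repr218.Holds` of the concrete representation. [cite: Balaban1988Convergent, (2.18) p.257] -/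
def Holds218 (𝒟 : Data218 P G av T ι D k) (ρ : Density P k G) : Prop :=
  𝒟.repr218.Holds ρ

/-- **THE DISPLAY (2.18) VERBATIM**: `Holds218 𝒟 ρ_k` says
`ρ_k(V_k) = Σ_{{Ω_j},{Λ_j}} χ_k(Ω_k)(V_k) · (𝐓_k({Ω_j},{Λ_j}) exp A_k(1/g_k², U_k))(V_k)`, the sum over the admissible
sequences, `χ_k` = (2.17) over the cubes `□ ⊂ Ω_k`, `U_k = U(𝐁({Ω_j}))(V)`. [cite: Balaban1988Convergent, (2.18) p.257] -/
theorem holds218_iff (𝒟 : Data218 P G av T ι D k) (ρ : Density P k G) :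
    𝒟.Holds218 ρ ↔ ∀ Vk : GaugeField P k G,
      ρ Vk = ∑ s : Seq D k,
        B14.Eq216Concrete.chi217 𝒟.bg 𝒟.M₁ (cubesIn 𝒟.cube (s.Ω k)) 𝒟.plaqT 𝒟.enl4 𝒟.εk k Vk *
          𝒟.Tk s (fun 𝔞 V =>
            Real.exp (({ 𝒟.act s with fluct := 𝔞 } : LFActionData P G T).action23 k (𝒟.bg.U (genSet s.Ω k) V))) Vk :=
  Iff.rfl

/-- The representation (2.18) regrouped by the last large-field region IS the decomposition (0.2) of
[Balaban1989LargeFieldI]: `ρ_k(V) = Σ_{Z} ρ(Z, V)`, `ρ(Z, V)` = the part of (2.18) with `Λ_kᶜ = Z` (pre-cell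
`Step.Repr218.sum_piece` for the concrete representation). [cite: Balaban1989LargeFieldI, (0.2) p.176] -/
theorem sum_piece218 (𝒟 : Data218 P G av T ι D k) {ρ : Density P k G} (h : 𝒟.Holds218 ρ) (Vk : GaugeField P k G) :
    ∑ Z, 𝒟.repr218.piece Z Vk = ρ Vk :=
  𝒟.repr218.sum_piece h Vk

/-- The no-large-field index has last large-field region `Z_k = ∅` — its summand is the small-field term `ρ(∅, ·)` of
(0.2) [Balaban1989LargeFieldI]. [cite: Balaban1988Convergent, (2.3) p.255, (2.18) p.257] -/
theorem lastZ_top (𝒟 : Data218 P G av T ι D k) (huniv : ∀ j, 1 ≤ j → j ≤ k → (Set.univ : Set (Site P 0)) ∈ D j)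
    (hk : 1 ≤ k) : 𝒟.repr218.lastZ (Seq.top D k huniv) = (∅ : Set (Site P 0)) := by
  rw [repr218_lastZ, Seq.top_Λ huniv hk, Set.compl_univ]

end Data218

end Representation

/-! ## §6  Where print consumes (2.18): the sign facts for Corollary 3 (2.50), PROVED for the concrete summands -/

section Consumption

variable {P : Params} {G : Type*} [GaugeGroup G] {av : ∀ j, Averaging P j G}
variable {Φ 𝒢 𝔄 : Type*} {T : LFTower P G Φ 𝒢 𝔄} {ι : Type*} [Fintype ι]
variable {D : ℕ → Set (Set (Site P 0))} {k : ℕ}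

namespace Data218

/-- An operation `𝐓_k(s)` PRESERVES POSITIVITY when it maps non-negative functions of the integration variables to
non-negative densities — the case of print's *«composition of integrations restricted to large field regions in
successive scales, and multiplications by characteristic functions, δ-functions …, and gauge fixing expressions»*
(p. 257). [cite: Balaban1988Convergent, (2.18) p.257] -/
def PositivityPreserving (𝒟 : Data218 P G av T ι D k) : Prop :=
  ∀ s (f : 𝔄 → MSField P G → ℝ), (∀ 𝔞 V, 0 ≤ f 𝔞 V) → ∀ Vk, 0 ≤ 𝒟.Tk s f Vk

/-- EVERY SUMMAND OF (2.18) IS NON-NEGATIVE when `𝐓_k` preserves positivity: `χ_k(Ω_k) ≥ 0` (a product of characteristic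
functions) and `exp A_k > 0` — the hypothesis `hnonneg` of the tree's consumer `B14Cor3.density_ge_of_repr218` (lower
half of (2.50)). [cite: Balaban1988Convergent, (2.18) p.257, Cor. 3 (2.50) p.264] -/
theorem term_nonneg (𝒟 : Data218 P G av T ι D k) (hT : 𝒟.PositivityPreserving) (s : Seq D k) (Vk : GaugeField P k G) :
    0 ≤ 𝒟.repr218.χ s Vk * 𝒟.repr218.TexpA s Vk :=
  mul_nonneg (chi218_nonneg _ _ _ _ _ _ _ _ _) (hT s _ (fun 𝔞 V => (expA_pos 𝒟.act 𝒟.bg s 𝔞 V).le) Vk)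

/-- EVERY SUMMAND OF (2.18) IS BOUNDED BY ITS `𝐓_k exp A_k` FACTOR when that factor is non-negative (`χ_k ≤ 1`) — the
shape in which the upper half of (2.50) consumes (2.18) (`B14Cor3.density_le_of_repr218`: majorants `w(s)` of the
summands). [cite: Balaban1988Convergent, (2.18) p.257, Cor. 3 (2.50) p.264] -/
theorem term_le_TexpA (𝒟 : Data218 P G av T ι D k) (hT : 𝒟.PositivityPreserving) (s : Seq D k) (Vk : GaugeField P k G) :
    𝒟.repr218.χ s Vk * 𝒟.repr218.TexpA s Vk ≤ 𝒟.repr218.TexpA s Vk := by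
  have h0 : 0 ≤ 𝒟.repr218.TexpA s Vk := hT s _ (fun 𝔞 V => (expA_pos 𝒟.act 𝒟.bg s 𝔞 V).le) Vk
  calc 𝒟.repr218.χ s Vk * 𝒟.repr218.TexpA s Vk ≤ 1 * 𝒟.repr218.TexpA s Vk :=
        mul_le_mul_of_nonneg_right (chi218_le_one _ _ _ _ _ _ _ _ _) h0
    _ = 𝒟.repr218.TexpA s Vk := one_mul _

/-- **THE LOWER HALF OF (2.50) FOR THE CONCRETE (2.18)** (p. 264, the tree's `B14Cor3.density_ge_of_repr218` fed with
`term_nonneg`): if `ρ_k` has the representation (2.18) with a positivity-preserving `𝐓_k`, then `ρ_k` is bounded below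
by any lower bound of ONE of its summands — print takes the no-large-field term (`Seq.top`). [cite: Balaban1988Convergent, Cor. 3 (2.50) p.264, (2.18) p.257] -/
theorem density_ge_of_term (𝒟 : Data218 P G av T ι D k) (hT : 𝒟.PositivityPreserving) {ρ : Density P k G}
    (h : 𝒟.Holds218 ρ) (s₀ : Seq D k) (lb : Density P k G)
    (hlow : ∀ Vk, lb Vk ≤ 𝒟.repr218.χ s₀ Vk * 𝒟.repr218.TexpA s₀ Vk) : ∀ Vk, lb Vk ≤ ρ Vk :=
  B14Cor3.density_ge_of_repr218 𝒟.repr218 h s₀ lb (fun s Vk => 𝒟.term_nonneg hT s Vk) hlow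

/-- **THE UPPER HALF OF (2.50) FOR THE CONCRETE (2.18)** (`B14Cor3.density_le_of_repr218` fed with `term_le_TexpA`):
with a positivity-preserving `𝐓_k`, majorants `w(s)` of the factors `𝐓_k(s) exp A_k` alone (the characteristic functions
dropped, `χ_k ≤ 1`) summing to `≤ B` bound `ρ_k ≤ B`. [cite: Balaban1988Convergent, Cor. 3 (2.50) p.264, (2.18) p.257] -/
theorem density_le_of_majorants (𝒟 : Data218 P G av T ι D k) (hT : 𝒟.PositivityPreserving) {ρ : Density P k G}
    (h : 𝒟.Holds218 ρ) (w : Seq D k → ℝ) {B : ℝ} (hw : ∀ s Vk, 𝒟.repr218.TexpA s Vk ≤ w s)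
    (hsum : ∑ s, w s ≤ B) : ∀ Vk, ρ Vk ≤ B :=
  B14Cor3.density_le_of_repr218 𝒟.repr218 h w (fun s Vk => (𝒟.term_le_TexpA hT s Vk).trans (hw s Vk)) hsum

end Data218

end Consumption

end Literature.MathematicalPhysics.QuantumFieldTheory.Balaban1983to89.B14.Eq218Concrete
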